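import Summits.ABC.ABC.Theorems.DefiniteXiFreyModularityIsModular
import Literature.NumberTheory.Automorphic.BCDTTheoremB
import Literature.NumberTheory.Automorphic.CDTTheorem712
import Literature.NumberTheory.Automorphic.CDTTheorem722
import Literature.NumberTheory.Automorphic.LanglandsTunnellModThree
import Literature.NumberTheory.Automorphic.StrongArtinGL2
import Literature.NumberTheory.Automorphic.PiOfArtinRepFrobSatakeCompatibleProofs
import Literature.NumberTheory.GaloisRepresentations.ProjectiveType
import HarnessLib

/-!
# STUB-IDEAS `stub_modThree` · ideator k1 (FAMILY 1 — recognise & import) · GENERATION 8 — companion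

Crux `FreyModularity` (stmt-ABC-11340), registered line `Lines/Sketch.lean` (sha 21576c53…), stub S1a
`stub_modThree` (l. 143).  This file kernel-checks the two compositions of `STUB-IDEAS-stub_modThree-1.md`
(gen 8):

* **PLAN F″ ("always switch" = BCDT 2001 Thm. 2.2.1, TAME CASE, as the tree proves it in
  `BCDT.exists_isTorsionGaloisRep_and_isModular_of_isTamelyRamifiedAbove`)**: on the Frey line S1a is
  consumed ONLY at a SURJECTIVE `ρ̄₃` — the auxiliary curve of the Shepherd-Barron–Taylor switch
  (`BCDT.exists_isTorsionGaloisRep_five_and_surjective_three`, an ADMITTED discharger of the registered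
  `stub_switch`, cf. `Sketch.stub_switch_of_exists_isTorsionGaloisRep_five_and_surjective_three`).  No case
  analysis on `E[3]` at all: `ρ̄_{E,5}` of EVERY Frey curve is absolutely irreducible over `ℚ(√5)`
  (landed S4a/S4b), so every Frey curve goes through the switch.  Kernel-checked, concluding the crux BY
  NAME: `FreyModularity_of_surjRoad : StubModThreeSurj → StubLiftThree → StubLiftFive →
  StubThreeImpTwo → exists_isTorsionGaloisRep_five_and_surjective_three → FreyFiveIrreducible →
  AbsIrrSqrtFive → NineTransfer → FreyModularity` (S1b, S2, S9 verbatim the registered stubs; the last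
  three are the verbatim types of the LANDED `isIrreducible_freyCurve_five`, `stub_absIrrSqrtFive`,
  `stub_nineTransfer`, carried as hypotheses only because this sketch's farm snapshot lacks their
  modules; S1a replaced by its surjective half; ZERO new helper lemmas — gen 7's F1/F2a/F2b/F4 and D⁷
  are not needed).
* **PLAN T^surj (the import for the surjective half)**: `StubModThreeSurj` from the TWO catalogued facts
  `strongArtin_of_isOctahedralType` (Tunnell 1981) and `exists_isNewform1_of_isPiOfArtinRep` (Gelbart
  1997 Prop. 4.2) — no dihedral (Jacquet–Langlands §12), no tetrahedral (Langlands 1980), no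
  Arthur–Clozel leaf — via three helper lemmas ALREADY PROVED in earlier companions of this ideator
  (restated here as `sorry` stubs with pointers, to keep this file's import closure small) and H4, H0
  re-proved here.  Composition: `FreyModularity_of_two_facts`.

`sorry` only in the three restated-proved helper stubs (`isOctahedralType_modThreeLift_of_surjective`
= g6 `o1_of_helpers`; `isModular_of_langlands_tunnell_at` = g2/g6 H1); every composition is
kernel-checked.  Nothing here is registered; the skeleton is untouched.
-/

noncomputable section

open scoped MatrixGroups NumberField
open NumberField IsDedekindDomain Field
open Literature.NumberTheory.EllipticCurves
open Literature.NumberTheory.EllipticCurves.ModularForms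
open Literature.NumberTheory.Automorphic
open Literature.NumberTheory.Automorphic.BCDT
open Literature.NumberTheory.GaloisRepresentations
open Literature.NumberTheory.GaloisRepresentations.GL2F3Lift
open WeierstrassCurve

set_option linter.dupNamespace false

namespace Summit.ABC.ABC.Cruxes.FreyModularity.Sketch.StubModThreeIdeasK1G8

/-! ## §0  The registered stubs as `Prop`s (VERBATIM `Lines/Sketch.lean` ll. 143–190) and the surjective half -/

/-- S1a `stub_modThree`, verbatim. -/
def StubModThree : Prop :=
  ∀ (W : WeierstrassCurve ℚ) [W.IsElliptic] (ρ : ModPGaloisRep ℚ (ZMod 3) 2),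
    W.IsTorsionGaloisRep 3 ρ → FramedRep.IsAbsolutelyIrreducible ρ → ρ.IsModular

/-- **S1a^surj** — the only instance of S1a the Frey line consumes (PLAN F″): Langlands–Tunnell for a
framed `ρ̄_{E,3}` ONTO `GL₂(𝔽₃)` (octahedral type after the lift `Ψ`). -/
def StubModThreeSurj : Prop :=
  ∀ (W : WeierstrassCurve ℚ) [W.IsElliptic] (ρ : ModPGaloisRep ℚ (ZMod 3) 2),
    W.IsTorsionGaloisRep 3 ρ → Function.Surjective ρ → ρ.IsModular

/-- S1b `stub_liftThree`, verbatim. -/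
def StubLiftThree : Prop :=
  ∀ (W : WeierstrassCurve ℚ) [W.IsElliptic] (ρ : ModPGaloisRep ℚ (ZMod 3) 2),
    W.IsTorsionGaloisRep 3 ρ → ρ.IsAbsIrreducibleOverSqrt (-3) → ¬ 9 ∣ W.conductorNorm ℤ →
    ρ.IsModular → W.IsModularGaloisRepTate 3

/-- S2 `stub_liftFive`, verbatim. -/
def StubLiftFive : Prop :=
  ∀ (W : WeierstrassCurve ℚ) [W.IsElliptic] (ρ : ModPGaloisRep ℚ (ZMod 5) 2),
    W.IsTorsionGaloisRep 5 ρ → ρ.IsAbsIrreducibleOverSqrt 5 → ¬ 25 ∣ W.conductorNorm ℤ →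
    ρ.IsModular → W.IsModularGaloisRepTate 5

/-- S9 `stub_threeImpTwo`, verbatim. -/
def StubThreeImpTwo : Prop :=
  ∀ (W : WeierstrassCurve ℚ) [W.IsElliptic] [NeZero (W.conductorNorm ℤ)] (ℓ : ℕ) [Fact ℓ.Prime],
    W.IsModularGaloisRepTate ℓ → BCDT.IsModular W

/-- LANDED (p118030 + reshape 3, `Summit.ABC.ABC.Theorems.isIrreducible_freyCurve_five`), verbatim type;
carried as a hypothesis only because the farm snapshot used for this sketch has not built that module. -/
def FreyFiveIrreducible : Prop :=
  ∀ a b : ℤ, IsCoprime a b → a * b * (a + b) ≠ 0 →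
    ∀ ρ : ModPGaloisRep ℚ (ZMod 5) 2, (freyCurve a b).IsTorsionGaloisRep 5 ρ →
      FramedRep.IsIrreducible ρ

/-- LANDED S4b (p102499, `Summit.ABC.ABC.Theorems.stub_absIrrSqrtFive`), verbatim type (hypothesis for the
same snapshot reason). -/
def AbsIrrSqrtFive : Prop :=
  ∀ (W : WeierstrassCurve ℚ) [W.IsElliptic], ¬ 25 ∣ W.conductorNorm ℤ →
    ∀ ρ : ModPGaloisRep ℚ (ZMod 5) 2, W.IsTorsionGaloisRep 5 ρ →
      FramedRep.IsIrreducible ρ → ρ.IsAbsIrreducibleOverSqrt 5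

/-- LANDED S6 (p110220, `Summit.ABC.ABC.Theorems.stub_nineTransfer`), verbatim type (hypothesis for the
same snapshot reason). -/
def NineTransfer : Prop :=
  ∀ (W W' : WeierstrassCurve ℚ) [W.IsElliptic] [W'.IsElliptic] (ρ : ModPGaloisRep ℚ (ZMod 5) 2),
    W.IsTorsionGaloisRep 5 ρ → W'.IsTorsionGaloisRep 5 ρ →
    ¬ 9 ∣ W.conductorNorm ℤ → ¬ 9 ∣ W'.conductorNorm ℤ

/-- The surjective half is a WEAKENING of the registered stub (so `stub_modThree` itself still feeds the
surjective road): onto `GL₂(𝔽₃)` ⇒ absolutely irreducible (tree: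
`isAbsIrreducibleOverSqrt_neg_three_of_surjective`). -/
theorem stubModThreeSurj_of_stubModThree (h : StubModThree) : StubModThreeSurj :=
  fun W _ ρ hρ hs ↦
    h W ρ hρ (isAbsIrreducibleOverSqrt_neg_three_of_surjective ρ hs).isAbsolutelyIrreducible

/-! ## §1  PLAN F″ — the switch road: every Frey curve through the Shepherd-Barron–Taylor auxiliary curve -/

/-- **F3** (PROVED, gen 7): the from-a-curve SURJECTIVE `3`–`5` switch is an instance of the tree's named
fact `BCDT.exists_isTorsionGaloisRep_five_and_surjective_three` (BCDT 2001 §2.2 / [SBT] §1 / Taylor 1997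
p. 344); the Weil-pairing determinant is the tree's
`det_eq_modPCyclotomicCharacter_of_isTorsionGaloisRep_holds`. -/
theorem switch_surjective_of_SBT (hE : exists_isTorsionGaloisRep_five_and_surjective_three) :
    ∀ (W : WeierstrassCurve ℚ) [W.IsElliptic] (ρ : ModPGaloisRep ℚ (ZMod 5) 2),
      W.IsTorsionGaloisRep 5 ρ → ρ.IsAbsIrreducibleOverSqrt 5 →
      ∃ (W' : WeierstrassCurve ℚ) (_ : W'.IsElliptic), W'.IsTorsionGaloisRep 5 ρ ∧
        ∃ ρ₃' : ModPGaloisRep ℚ (ZMod 3) 2, W'.IsTorsionGaloisRep 3 ρ₃' ∧ Function.Surjective ρ₃' := by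
  intro W _ ρ hρ h5
  exact hE ρ h5.isAbsolutelyIrreducible (W.det_eq_modPCyclotomicCharacter_of_isTorsionGaloisRep_holds 5 ρ hρ)

/-- **`liftThree` in surjective form** (PROVED; = the skeleton's `liftThree_of_stubs` with S1a replaced by
its surjective half — `Surjective ⇒` absolutely irreducible over `ℚ(√-3)` is the tree's
`isAbsIrreducibleOverSqrt_neg_three_of_surjective`, exactly as in the tree's
`BCDT.exists_isTorsionGaloisRep_and_isModular_of_isTamelyRamifiedAbove`). -/
theorem liftThree_of_surjStubs (hmod3 : StubModThreeSurj) (hlift3 : StubLiftThree)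
    (h32 : StubThreeImpTwo) :
    ∀ (W : WeierstrassCurve ℚ) [W.IsElliptic] [NeZero (W.conductorNorm ℤ)]
      (ρ : ModPGaloisRep ℚ (ZMod 3) 2), W.IsTorsionGaloisRep 3 ρ →
      Function.Surjective ρ → ¬ 9 ∣ W.conductorNorm ℤ → BCDT.IsModular W :=
  fun W _ _ ρ hρ hs h9 ↦
    haveI : Fact (Nat.Prime 3) := ⟨Nat.prime_three⟩
    h32 W 3 (hlift3 W ρ hρ (isAbsIrreducibleOverSqrt_neg_three_of_surjective ρ hs) h9 (hmod3 W ρ hρ hs))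

/-- The skeleton's `liftFive_of_stubs`, over the `Prop` names of §0 (PROVED, verbatim glue). -/
theorem liftFive_of_stubs' (hlift5 : StubLiftFive) (h32 : StubThreeImpTwo) :
    ∀ (W : WeierstrassCurve ℚ) [W.IsElliptic] [NeZero (W.conductorNorm ℤ)],
      ¬ 25 ∣ W.conductorNorm ℤ →
      ∀ (ρ : ModPGaloisRep ℚ (ZMod 5) 2), W.IsTorsionGaloisRep 5 ρ →
      ρ.IsAbsIrreducibleOverSqrt 5 → ρ.IsModular → BCDT.IsModular W :=
  fun W _ _ h25 ρ hρ hirr hmod ↦ h32 W 5 (hlift5 W ρ hρ hirr h25 hmod)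

/-- `25 ∤ N_{E_(a,b)}` (verbatim the skeleton's `not_twentyFive_dvd_conductorNorm_freyCurve`, which lives
in the non-importable `Lines/Sketch.lean`; same proof as the landed
`Summit.ABC.ABC.Theorems.not_nine_dvd_conductorNorm_freyCurve`). -/
theorem not_twentyFive_dvd_conductorNorm_freyCurve {a b : ℤ} (hab : IsCoprime a b)
    (h0 : a * b * (a + b) ≠ 0) : ¬ 25 ∣ (freyCurve a b).conductorNorm ℤ := by
  intro h25
  have hdvd := conductorNorm_freyCurve_dvd_holds a b hab h0
  have h25' : 25 ∣ 2 ^ 8 * (UniqueFactorizationMonoid.radical (a * b * (a + b))).natAbs :=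
    h25.trans hdvd
  have hcop : Nat.Coprime 25 (2 ^ 8) := by norm_num
  have h25r : 25 ∣ (UniqueFactorizationMonoid.radical (a * b * (a + b))).natAbs :=
    hcop.dvd_of_dvd_mul_left h25'
  have hsq : Squarefree (UniqueFactorizationMonoid.radical (a * b * (a + b))).natAbs :=
    Int.squarefree_natAbs.mpr UniqueFactorizationMonoid.squarefree_radical
  have h5 : IsUnit (5 : ℕ) := hsq 5 ((show (5 : ℕ) * 5 = 25 by norm_num) ▸ h25r)
  exact absurd (Nat.isUnit_iff.mp h5) (by norm_num)

/-- **F″0 — every Frey curve is modular along the SWITCH ROAD ONLY** (PROVED; the skeleton's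
`isModular_freyCurve_of_stubs` with case A and the hypothesis `hB` DELETED and the switch in the
Shepherd-Barron–Taylor surjective form): `ρ̄_{E,5}` is irreducible (landed
`Summit.ABC.ABC.Theorems.isIrreducible_freyCurve_five`, reshape 3) and absolutely irreducible over `ℚ(√5)`
(landed S4b `stub_absIrrSqrtFive`, `25 ∤ N`); the switch gives `E'` with `E'[5] ≅ E[5]` and `ρ̄_{E',3}`
ONTO; `9 ∤ N_{E'}` (landed S6 `stub_nineTransfer` — so neither Ogg–Saito nor `27 ∤ N` is needed); `E'`
is modular by `h1` = S1a^surj + S1b + S9 (`liftThree_of_surjStubs`); hence `ρ̄_{E,5}` is modular (tree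
`IsModular.isModular_of_isTorsionGaloisRep''`) and `E` is modular by `h2` = S2 + S9.  This is BCDT 2001,
proof of Thm. 2.2.1, case 1 (tame), run on `ρ̄ = ρ̄_{E,5}` of a Frey curve. -/
theorem isModular_freyCurve_of_switchRoad
    (h1 : ∀ (W : WeierstrassCurve ℚ) [W.IsElliptic] [NeZero (W.conductorNorm ℤ)]
      (ρ : ModPGaloisRep ℚ (ZMod 3) 2), W.IsTorsionGaloisRep 3 ρ →
      Function.Surjective ρ → ¬ 9 ∣ W.conductorNorm ℤ → BCDT.IsModular W)
    (h2 : ∀ (W : WeierstrassCurve ℚ) [W.IsElliptic] [NeZero (W.conductorNorm ℤ)],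
      ¬ 25 ∣ W.conductorNorm ℤ →
      ∀ (ρ : ModPGaloisRep ℚ (ZMod 5) 2), W.IsTorsionGaloisRep 5 ρ →
      ρ.IsAbsIrreducibleOverSqrt 5 → ρ.IsModular → BCDT.IsModular W)
    (hSBT : exists_isTorsionGaloisRep_five_and_surjective_three)
    (h4a : FreyFiveIrreducible) (h4b : AbsIrrSqrtFive) (h6 : NineTransfer)
    {a b : ℤ} (hab : IsCoprime a b) (h0 : a * b * (a + b) ≠ 0)
    [NeZero ((freyCurve a b).conductorNorm ℤ)] : BCDT.IsModular (freyCurve a b) := by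
  haveI := isElliptic_freyCurve h0
  haveI : Fact (Nat.Prime 5) := ⟨by norm_num⟩
  have h9 : ¬ 9 ∣ (freyCurve a b).conductorNorm ℤ :=
    Summit.ABC.ABC.Theorems.not_nine_dvd_conductorNorm_freyCurve hab h0
  have h25 : ¬ 25 ∣ (freyCurve a b).conductorNorm ℤ :=
    not_twentyFive_dvd_conductorNorm_freyCurve hab h0
  obtain ⟨ρ, hρ⟩ := (freyCurve a b).exists_isTorsionGaloisRep 5
  have hirr : FramedRep.IsIrreducible ρ := h4a a b hab h0 ρ hρ
  have h5 : ρ.IsAbsIrreducibleOverSqrt 5 := h4b (freyCurve a b) h25 ρ hρ hirr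
  -- the surjective `3`–`5` switch, for EVERY Frey curve (no case analysis on `E[3]`)
  obtain ⟨W', hW', hρ', ρ₃', hρ₃', hs'⟩ := switch_surjective_of_SBT hSBT (freyCurve a b) ρ hρ h5
  haveI := hW'
  haveI : NeZero (W'.conductorNorm ℤ) := ⟨(conductorNorm_pos_holds W').ne'⟩
  have h9' : ¬ 9 ∣ W'.conductorNorm ℤ := h6 (freyCurve a b) W' ρ hρ hρ' h9
  have hE' : BCDT.IsModular W' := h1 W' ρ₃' hρ₃' hs' h9'
  have hρmod : ρ.IsModular := hE'.isModular_of_isTorsionGaloisRep'' hρ'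
  exact h2 (freyCurve a b) h25 ρ hρ h5 hρmod

/-- ★ **PLAN F″, kernel-checked: the crux BY NAME from S1a^surj, the registered S1b/S2/S9 and the SBT
switch fact.**  Versus the registered `FreyModularity_of`: `stub_modThree ↦ StubModThreeSurj` (weaker,
`stubModThreeSurj_of_stubModThree`), `stub_switch ↦ exists_isTorsionGaloisRep_five_and_surjective_three`
(one of its two admitted dischargers); nothing else changes, no new helper lemma. -/
theorem FreyModularity_of_surjRoad (hmod3 : StubModThreeSurj) (hlift3 : StubLiftThree)
    (hlift5 : StubLiftFive) (h32 : StubThreeImpTwo)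
    (hSBT : exists_isTorsionGaloisRep_five_and_surjective_three)
    (h4a : FreyFiveIrreducible) (h4b : AbsIrrSqrtFive) (h6 : NineTransfer) :
    Summit.ABC.ABC.Theses.DefiniteXi.FreyModularity :=
  Summit.ABC.ABC.Theorems.freyModularity_iff_forall_isModular_freyCurve.mpr
    fun _ _ hab h0 _ ↦ isModular_freyCurve_of_switchRoad
      (liftThree_of_surjStubs hmod3 hlift3 h32) (liftFive_of_stubs' hlift5 h32) hSBT h4a h4b h6 hab h0

/-! ## §2  PLAN T^surj — the surjective half from Tunnell 1981 + Gelbart Prop. 4.2 -/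

/-- **O1** (PROVED in `STUB_IDEAS_stub_modThree_1_g6.lean` as `o1_of_helpers`, sorry-free, ten helper
lemmas A1–B4: `PGL₂(𝔽₃) ≃ S₄` by the faithful action on the four points of `ℙ¹(𝔽₃)`): a framed `ρ̄`
onto `GL₂(𝔽₃)` has octahedral lift `Ψ ∘ ρ̄`.  Restated here as a stub only to keep the import closure
of this file small (landable `--supports stmt-ABC-11340`). -/
theorem isOctahedralType_modThreeLift_of_surjective (ρ : ModPGaloisRep ℚ (ZMod 3) 2)
    (hs : Function.Surjective ρ) : IsOctahedralType (modThreeLift ρ).toMonoidHom := by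
  sorry

/-- **H1** (PROVED in `STUB_IDEAS_stub_modThree_1_g6.lean` l. 269, 80 lines = the tree's
`ModPGaloisRep.isModular_of_isAbsolutelyIrreducible_of_isOdd_of_langlands_tunnell` with its global
hypothesis `∀ σ, langlands_tunnell σ` LOCALISED to `σ = Ψ ∘ ρ̄`, the only instance that proof uses).
Proposed as a one-cycle Literature helper (`LanglandsTunnellModThree`): restated here as a stub. -/
theorem isModular_of_langlands_tunnell_at (ρ : ModPGaloisRep ℚ (ZMod 3) 2)
    (hLT : langlands_tunnell (modThreeLift ρ))
    (habs : FramedRep.IsAbsolutelyIrreducible ρ) (hodd : FramedGaloisRep.IsOdd ρ) : ρ.IsModular := by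
  sorry

/-- **H0** (PROVED, verbatim the tree's proof inside
`WeierstrassCurve.isModular_of_isTorsionGaloisRep_three_of_langlands_tunnell`): `ρ̄_{E,3}` is odd. -/
theorem isOdd_of_isTorsionGaloisRep_three (W : WeierstrassCurve ℚ) [W.IsElliptic]
    (ρ : ModPGaloisRep ℚ (ZMod 3) 2) (hρ : W.IsTorsionGaloisRep 3 ρ) :
    FramedGaloisRep.IsOdd ρ := by
  haveI : NeZero ((3 : ℕ) : ℚ) := ⟨by norm_num⟩
  intro φ c hc
  rw [W.det_eq_modPCyclotomicCharacter_of_isTorsionGaloisRep_holds 3 ρ hρ c]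
  ext
  rw [modPCyclotomicCharacterZMod_eq_modNCyclotomicCharacter,
    modNCyclotomicCharacter_of_isComplexConjugation hc, Units.val_neg, Units.val_one]

/-- **H4** (PROVED, gen 2/6): Langlands–Tunnell for ONE `σ` from the existence of `π(σ)` and Gelbart
Prop. 4.2 (`exists_isNewform1_of_isPiOfArtinRep`); Prop. 4.1 is the tree THEOREM
`frobSatakeCompatibleAt_of_isPiOfArtinRep_holds`. -/
theorem langlands_tunnell_of_exists_isPiOfArtinRep (hW1 : exists_isNewform1_of_isPiOfArtinRep)
    (σ : FramedArtinRep ℚ 2)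
    (hπ : σ.toGaloisRep.IsIrreducible →
      ∃ (hcpt : isCompact_glFiniteIntegralLevel 2 ℚ) (π : CuspidalAutomorphicRepData 2 ℚ hcpt),
        IsPiOfArtinRep σ π.1) :
    langlands_tunnell σ := by
  intro hirr hodd _hsolv
  obtain ⟨hcpt, π, hπ⟩ := hπ hirr
  obtain ⟨N, hN, f, hf, -, hsat⟩ := hW1 hcpt σ π hirr hodd hπ
  refine ⟨N, hN, f, hf, fun v hv => ?_⟩
  obtain ⟨α, hα, hpoly⟩ := hsat v hv
  obtain ⟨hur, hchar⟩ := frobSatakeCompatibleAt_of_isPiOfArtinRep_holds hcpt σ π hπ v α hα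
  exact ⟨hur, hpoly ▸ hchar⟩

/-- ★ **PLAN T^surj, kernel-checked: `StubModThreeSurj` from the TWO catalogued facts
`strongArtin_of_isOctahedralType` (Tunnell 1981, Theorem) and `exists_isNewform1_of_isPiOfArtinRep`
(Gelbart 1997, Prop. 4.2)**, through O1 (octahedral type), H0 (odd), H4 and the localised descent H1;
absolute irreducibility over `ℚ` comes free from surjectivity.  No dihedral / tetrahedral / nilpotent
leaf: the surjective `ρ̄₃` never meets them. -/
theorem stubModThreeSurj_of_two_facts (ho : strongArtin_of_isOctahedralType)
    (hW1 : exists_isNewform1_of_isPiOfArtinRep) : StubModThreeSurj := by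
  intro W _ ρ hρ hs
  have habs : FramedRep.IsAbsolutelyIrreducible ρ :=
    (isAbsIrreducibleOverSqrt_neg_three_of_surjective ρ hs).isAbsolutelyIrreducible
  have hodd : FramedGaloisRep.IsOdd ρ := isOdd_of_isTorsionGaloisRep_three W ρ hρ
  refine isModular_of_langlands_tunnell_at ρ ?_ habs hodd
  exact langlands_tunnell_of_exists_isPiOfArtinRep hW1 (modThreeLift ρ) fun hirr' ↦
    ho (modThreeLift ρ) hirr' (isOctahedralType_modThreeLift_of_surjective ρ hs)

/-- ★★ **The Frey crux from two automorphic facts + the switch + the engines S1b, S2, S9** (kernel-checked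
modulo the restated-proved O1/H1): `FreyModularity` from {Tunnell 1981, Gelbart Prop. 4.2, [SBT] auxiliary
curve} and the registered `stub_liftThree`, `stub_liftFive`, `stub_threeImpTwo`.  Compare the registered
pointer `stub_modThree_of_langlands_tunnell ∘ langlands_tunnell_of_three_cases`, which needs in addition
`strongArtin_of_isDihedralType` (JL §12) and `strongArtin_of_isTetrahedralType` (Langlands 1980). -/
theorem FreyModularity_of_two_facts (ho : strongArtin_of_isOctahedralType)
    (hW1 : exists_isNewform1_of_isPiOfArtinRep)
    (hSBT : exists_isTorsionGaloisRep_five_and_surjective_three)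
    (hlift3 : StubLiftThree) (hlift5 : StubLiftFive) (h32 : StubThreeImpTwo)
    (h4a : FreyFiveIrreducible) (h4b : AbsIrrSqrtFive) (h6 : NineTransfer) :
    Summit.ABC.ABC.Theses.DefiniteXi.FreyModularity :=
  FreyModularity_of_surjRoad (stubModThreeSurj_of_two_facts ho hW1) hlift3 hlift5 h32 hSBT h4a h4b h6

end Summit.ABC.ABC.Cruxes.FreyModularity.Sketch.StubModThreeIdeasK1G8

end
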